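import Summits.QuantumFields.BalabanUV.Beta.EriceFlowEnclosureB12AsPrintedHistoryNonuniqueBandsSetting

/-!
# Beta / EriceFlowEnclosureB12AsPrintedHistoryContagionSharp — the two load-bearing inputs of the AF contagion (`…HistoryContagion`,
# `…HistoryContagionProfile`, `…HistoryContagionEnd`): FADING MEMORY (θ < 1) and the existence of ONE REFERENCE RUN, certified by kernel
# witnesses; the second witness also certifies that the box-versus-modulus smallness `4Cγ³ ≤ (1 − θ)²` of prover 2's reference-free
# `…PointwiseFadingOrder.runs_eq_of_fadingMemory_signFree` (gen 44) cannot be dropped (β-flow team, prover 1 = recursion ∕ upper ∕ bare-coupling ∕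
# UNIQUENESS side, unit `b2b-balaban-beta-bflow-p1`, gen 35; ROW AP-I·U, fourth reading; imports gen 34's #62j `…HistoryNonuniqueBandsSetting` only —
# the contagion files are referred to BY NAME in prose, not imported)

HONEST FRAMING (page 1 of everything the β sub-cell writes): discharging `BetaPertH` makes Bałaban's UV stability UNCONDITIONAL — a
real constructive-QFT result; it is NOT the continuum limit and NOT the Clay problem.  HONEST DEPENDENCY (cell reorg 2026-08-19,
verbatim): «continuum YM on T⁴ ⇐ BetaPertH ∧ nine spine estimates (0/9 proved); BetaPertH ⇐ (D1) ∧ (D4) ∧ CAP+tail; G-an2-4 gates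
asym, D1 and NE2/3/4.»  THIS MODULE DISCHARGES NOTHING: two WITNESS FAMILIES OF OURS for history-dependent β-functions of the printed
recursion (0.20) of [I] = T. Bałaban, Commun. Math. Phys. **109** (1987) [Balaban1987RG1] (p. 298: β_j *"depends also on all preceding coupling
constants"*) under node U2's HYPOTHESIS SHAPES `T4CouplingMatching.HistLipschitz ∕ FadingMemory` (NOT printed), one of them gen 34's multi-band
`Setting` read again; the shapes negated are those of the contagion theorems.  Nothing of Bałaban's β is asserted.

THE POINT.  The contagion (`…HistoryContagionProfile.inv_sq_lower_of_reference` ∕ `runs_eq_of_reference_fadingMemory`,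
`…HistoryContagionEnd.theorem2_unique_bigBox_typed`) says: coupling-chart moduli with FADING MEMORY (θ < 1) + ONE run carrying (0.31)'s lower half
from its end ⟹ every same-depth run in the box ending at a small coupling g stays below 2g, is asymptotically free at a quarter of the rate,
and is unique given its endpoint — in a box of ANY size against the modulus.  Both inputs are load-bearing:
(§1) AT θ = 1 the big-box uniqueness conclusion is FALSE even with Theorem 2 AS TYPED, `Definitions` and the binder `hrg` in force (gen 34's
multi-band `Setting`, `bandsToy_exists`: two bare couplings with in-interval rows of the same depth ending at g_m → 0) —
**`bigBoxUnique_fails_at_theta_one`**;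
(§2) WITHOUT a reference run the moduli alone — for ANY θ, even for a MARKOV family — give NO endpoint threshold: β₁(g₀) = 6(1 − g₀), β_{l+1} ≡ −1
(l ≥ 1) has the runs (1, 1, 2^{−1∕2}, …, K^{−1∕2}) and (½, 1, 2^{−1∕2}, …, K^{−1∕2}) of (0.20) for every K ≥ 1 — same depth, box ]0, 1], SAME endpoint
K^{−1∕2} → 0, DIFFERENT bare couplings: the one-step map x ↦ x + 6∕√x − 6 FOLDS (it takes the value 1 at x = 1 and at x = 4; Cγ³ = 6 > 2 is row U's
fold regime) and the anti-free tail carries both branches to zero (**`noReference_twoRuns`**, **`no_threshold_without_reference`**).  The same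
family violates prover 2's `4Cγ³ ≤ (1 − θ)²` (gen 44, `…PointwiseFadingOrder`: reference-free, sign-free uniqueness in a SMALL box by the forward
order argument) for every θ: that smallness is load-bearing there, and is exactly what ONE reference run removes here.

WHAT THIS FILE PROVES (0 sorry, 0 def): §1 **`bigBoxUnique_fails_at_theta_one`**; §2 `noReference_twoRuns`, **`no_threshold_without_reference`**.
NOT CLAIMED: any modulus, sign or bound for Bałaban's β; Theorem 2; `BetaPertH`; continuum; Clay.
-/

namespace Summit.QuantumFields.BalabanUV.Beta.EriceFlowEnclosureB12AsPrintedHistoryContagionSharp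

open Finset
open Literature.MathematicalPhysics.QuantumFieldTheory.Balaban1983to89
open Literature.MathematicalPhysics.QuantumFieldTheory.Balaban1983to89.B12BetaAsPrinted
open Literature.MathematicalPhysics.QuantumFieldTheory.Balaban1983to89.FlowStep (HBeta prefixOf Box mem_box box_mono RGEqH BetaUpperH)
open Literature.MathematicalPhysics.QuantumFieldTheory.Balaban1983to89.T4CouplingMatching (HistLipschitz FadingMemory)
open Summit.QuantumFields.BalabanUV.Beta.EriceFlowEnclosureB12AsPrintedTunedUpper (hrg_of_betaUpperH)
open Summit.QuantumFields.BalabanUV.Beta.EriceFlowEnclosureB12AsPrintedHistoryNonuniqueBandsSetting (bandsToy_exists)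

noncomputable section

/-! ## §1 Fading memory is load-bearing: at θ = 1 the big-box uniqueness fails, even with Theorem 2 in force -/

/-- **AT θ = 1 THE CONTAGION'S UNIQUENESS CONCLUSION IS FALSE — even with Theorem 2 AS TYPED, `Definitions` and `hrg` in force.**  The shape negated
is `…HistoryContagionEnd.theorem2_unique_bigBox_typed` with `FadingMemory C θ Λ`, θ < 1 REPLACED by `FadingMemory C 1 Λ` (the uniform coordinatewise
modulus): «∃ g₂ > 0 such that two in-box rows of the same depth with the same endpoint ≤ g₂ have the same bare coupling».  Witness: gen 34's
multi-band `Setting` (`bandsToy_exists` at box 1∕5, any C > 0): `StandingHypotheses ∧ Definitions ∧ Conclusions`, `Theorem2Statement`, (U) with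
(b + b)(1∕5)² < 1 (whence `hrg` by `…TunedUpper.hrg_of_betaUpperH`), `HistLipschitz Λ (1∕5) S.β` with `FadingMemory C 1 Λ`, and at every depth
scale m two bare couplings g₀ ≠ g₀′ with rows in ]0, g_m] ⊆ ]0, 1∕5] of the same depth BOTH ending at g_m ≤ 1∕(m + 1).
[cite: Balaban1987RG1, Thm 2 p.259 («g₀ = g₀(ε, g)») with (0.20) p.256 and p.298] -/
theorem bigBoxUnique_fails_at_theta_one {C : ℝ} (hC : 0 < C) :
    ¬ (∀ (S : Setting) (hL : Odd S.L ∧ 1 < S.L), Theorem2Statement S hL → Definitions S →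
        ∀ (γu : ℝ) (Λ : ℕ → ℕ → ℝ), 0 < γu →
        (∀ P : B12.RunParams, Step.InInterval γu P.K (S.cpl P) → RGEqH P.K S.β (S.cpl P)) →
        HistLipschitz Λ γu S.β → FadingMemory C 1 Λ →
        ∀ m : ℕ, ∃ g₂ : ℝ, 0 < g₂ ∧ ∀ (K : ℕ) (g₀ g₀' : ℝ),
          Step.InInterval γu K (S.cpl ⟨K, m, g₀⟩) → Step.InInterval γu K (S.cpl ⟨K, m, g₀'⟩) →
          S.cpl ⟨K, m, g₀⟩ K = S.cpl ⟨K, m, g₀'⟩ K → S.cpl ⟨K, m, g₀⟩ K ≤ g₂ → g₀ = g₀') := by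
  intro h
  have hγ : (0 : ℝ) < 1 / 5 := by norm_num
  obtain ⟨S, hH, hD, -, hSγ, hT2, -, -, hup, -, ⟨Λ, hL, hΛ⟩, gb, hgb, hruns⟩ := bandsToy_exists (γ := 1 / 5) one_pos hC one_pos hγ
  have hbu : (1 + 1) * (1 / 5 : ℝ) ^ 2 < 1 := by norm_num
  have hrg : ∀ P : B12.RunParams, Step.InInterval (1 / 5) P.K (S.cpl P) → RGEqH P.K S.β (S.cpl P) :=
    fun P hI => hrg_of_betaUpperH hD hγ hup hbu P hI
  obtain ⟨g₂, hg₂, huniq⟩ := h S (hL_of_standing hH) hT2 hD (1 / 5) Λ hγ hrg hL hΛ 0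
  -- a band with target below g₂
  obtain ⟨m, hm⟩ := exists_nat_gt (1 / g₂)
  have hgm : gb m ≤ g₂ := by
    have h1 : 1 / ((m : ℝ) + 1) ≤ g₂ := by
      rw [div_le_iff₀ (by positivity)]
      have := (div_lt_iff₀ hg₂).mp hm
      nlinarith
    exact (hgb m).2.2.trans h1
  obtain ⟨K, g₀, g₀', hne, -, -, hI, hI', hend, hend'⟩ := hruns m
  have hIγ : Step.InInterval (1 / 5) K (S.cpl ⟨K, 0, g₀⟩) := fun k hk => ⟨(hI k hk).1, (hI k hk).2.trans (hgb m).2.1⟩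
  have hIγ' : Step.InInterval (1 / 5) K (S.cpl ⟨K, 0, g₀'⟩) := fun k hk => ⟨(hI' k hk).1, (hI' k hk).2.trans (hgb m).2.1⟩
  exact hne (huniq K g₀ g₀' hIγ hIγ' (hend.trans hend'.symm) (hend.le.trans hgm))

/-! ## §2 The reference run is load-bearing: a Markov fold followed by an anti-free tail -/

/-- **WITHOUT A REFERENCE RUN THE MODULI DO NOT GIVE UNIQUENESS NEAR ZERO — a Markov fold followed by an anti-free tail.**  For every depth K ≥ 1: the
family β₁(g₀) = 6(1 − g₀), β_{l+1} ≡ −1 (l ≥ 1) — a MARKOV family, `HistLipschitz Λ 1` with Λ 0 0 = 6 and Λ = 0 otherwise, hence `FadingMemory 6 θ Λ`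
for EVERY θ ≥ 0 — has the two runs (1, 1, 2^{−1∕2}, 3^{−1∕2}, …, K^{−1∕2}) and (½, 1, 2^{−1∕2}, …, K^{−1∕2}) of (0.20): the same depth, all couplings in
]0, 1], the SAME endpoint K^{−1∕2}, DIFFERENT bare couplings (the one-step map x ↦ x + 6∕√x − 6 folds: it takes the value 1 at x = 1 and at x = 4;
6 = Cγ³ > 2 is row U's fold regime).  No run of this family carries (0.31)'s lower half at a positive rate (the tail is anti-free), so the contagion
does not apply — and its conclusion fails at the endpoint K^{−1∕2}, as small as desired.  A family of OURS, wrapped in a `Setting` whose other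
fields are junk (only `S.β` is read). [cite: Balaban1987RG1, (0.20) p.256 with p.298] -/
theorem noReference_twoRuns (K : ℕ) (hK : 1 ≤ K) :
    ∃ (S : Setting) (Λ : ℕ → ℕ → ℝ) (g g' : ℕ → ℝ),
      HistLipschitz Λ 1 S.β ∧ (∀ θ : ℝ, 0 ≤ θ → FadingMemory 6 θ Λ) ∧
      RGEqH K S.β g ∧ RGEqH K S.β g' ∧
      (∀ i, i ≤ K → 0 < g i ∧ g i ≤ 1) ∧ (∀ i, i ≤ K → 0 < g' i ∧ g' i ≤ 1) ∧
      g K = g' K ∧ g K = 1 / Real.sqrt K ∧ g 0 ≠ g' 0 := by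
  -- the family and its modulus
  let β : HBeta := fun l p => if l = 0 then 6 * (1 - p 0) else -1
  let Λ : ℕ → ℕ → ℝ := fun l i => if l = 0 ∧ i = 0 then 6 else 0
  -- the two runs
  let g : ℕ → ℝ := fun i => if i = 0 then 1 else 1 / Real.sqrt i
  let g' : ℕ → ℝ := fun i => if i = 0 then 1 / 2 else 1 / Real.sqrt i
  -- a Setting carrying β (every other field is junk: only S.β is read)
  refine ⟨⟨13, True, 1, fun P _ => P.g0, β, 1, 1, 1, fun _ => Unit, fun _ => (), fun _ _ => 0, fun _ _ _ => 0, fun _ _ _ => 0,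
      fun _ _ _ => True, 1, 1, 1, fun _ => 1, fun _ _ => fun _ _ _ => 0, fun _ _ => fun _ _ _ => 0, 1, fun _ _ => True, 1, True,
      fun _ _ => 0, 1, 1, 1, 1⟩, Λ, g, g', ?_, ?_, ?_, ?_, ?_, ?_, ?_, ?_, ?_⟩
  · -- HistLipschitz Λ 1 β
    intro k p q hp hq
    by_cases hk : k = 0
    · subst hk
      show |(if (0 : ℕ) = 0 then 6 * (1 - p 0) else -1) - (if (0 : ℕ) = 0 then 6 * (1 - q 0) else -1)|
        ≤ ∑ i : Fin 1, (if (0 : ℕ) = 0 ∧ ((i : ℕ)) = 0 then (6 : ℝ) else 0) * |p i - q i|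
      simp only [if_true, Fin.sum_univ_one, Fin.val_zero, and_self]
      rw [show (6 : ℝ) * (1 - p 0) - 6 * (1 - q 0) = -(6 * (p 0 - q 0)) by ring, abs_neg, abs_mul,
        abs_of_pos (by norm_num : (0 : ℝ) < 6)]
    · show |(if k = 0 then 6 * (1 - p 0) else -1) - (if k = 0 then 6 * (1 - q 0) else -1)|
        ≤ ∑ i : Fin (k + 1), (if k = 0 ∧ ((i : ℕ)) = 0 then (6 : ℝ) else 0) * |p i - q i|
      simp only [hk, if_false, false_and, sub_self, abs_zero, zero_mul, Finset.sum_const_zero, le_refl]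
  · -- FadingMemory 6 θ Λ for every θ ≥ 0
    intro θ hθ k i hik
    by_cases h0 : k = 0 ∧ i = 0
    · obtain ⟨rfl, rfl⟩ := h0
      refine ⟨by simp [Λ], ?_⟩
      simp [Λ]
    · refine ⟨by simp [Λ, h0], ?_⟩
      simp only [Λ, h0, if_false]
      positivity
  · -- RGEqH K β g
    intro k hk
    by_cases hk0 : k = 0
    · subst hk0
      show 1 / (if (0 : ℕ) = 0 then (1 : ℝ) else 1 / Real.sqrt (0 : ℕ)) ^ 2
        = 1 / (if (0 + 1 : ℕ) = 0 then (1 : ℝ) else 1 / Real.sqrt ((0 + 1 : ℕ) : ℝ)) ^ 2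
          + (if (0 : ℕ) = 0 then 6 * (1 - (prefixOf g 0) 0) else -1)
      simp [g]
    · have hk1 : (k : ℝ) ≥ 1 := by exact_mod_cast Nat.one_le_iff_ne_zero.mpr hk0
      show 1 / (if k = 0 then (1 : ℝ) else 1 / Real.sqrt k) ^ 2
        = 1 / (if k + 1 = 0 then (1 : ℝ) else 1 / Real.sqrt ((k + 1 : ℕ) : ℝ)) ^ 2 + (if k = 0 then 6 * (1 - (prefixOf g k) 0) else -1)
      simp only [hk0, if_false, Nat.succ_ne_zero, one_div_pow, one_div_one_div]
      rw [Real.sq_sqrt (by positivity), Real.sq_sqrt (by positivity)]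
      push_cast
      ring
  · -- RGEqH K β g'
    intro k hk
    by_cases hk0 : k = 0
    · subst hk0
      show 1 / (if (0 : ℕ) = 0 then (1 / 2 : ℝ) else 1 / Real.sqrt (0 : ℕ)) ^ 2
        = 1 / (if (0 + 1 : ℕ) = 0 then (1 / 2 : ℝ) else 1 / Real.sqrt ((0 + 1 : ℕ) : ℝ)) ^ 2
          + (if (0 : ℕ) = 0 then 6 * (1 - (prefixOf g' 0) 0) else -1)
      simp [g']
      norm_num
    · show 1 / (if k = 0 then (1 / 2 : ℝ) else 1 / Real.sqrt k) ^ 2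
        = 1 / (if k + 1 = 0 then (1 / 2 : ℝ) else 1 / Real.sqrt ((k + 1 : ℕ) : ℝ)) ^ 2 + (if k = 0 then 6 * (1 - (prefixOf g' k) 0) else -1)
      simp only [hk0, if_false, Nat.succ_ne_zero, one_div_pow, one_div_one_div]
      rw [Real.sq_sqrt (by positivity), Real.sq_sqrt (by positivity)]
      push_cast
      ring
  · -- g in ]0, 1]
    intro i hi
    by_cases hi0 : i = 0
    · subst hi0; simp [g]
    · have hi1 : (1 : ℝ) ≤ i := by exact_mod_cast Nat.one_le_iff_ne_zero.mpr hi0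
      simp only [g, hi0, if_false]
      refine ⟨by positivity, ?_⟩
      rw [div_le_one (Real.sqrt_pos.mpr (by positivity))]
      exact Real.one_le_sqrt.mpr hi1
  · -- g' in ]0, 1]
    intro i hi
    by_cases hi0 : i = 0
    · subst hi0; simp [g']; norm_num
    · have hi1 : (1 : ℝ) ≤ i := by exact_mod_cast Nat.one_le_iff_ne_zero.mpr hi0
      simp only [g', hi0, if_false]
      refine ⟨by positivity, ?_⟩
      rw [div_le_one (Real.sqrt_pos.mpr (by positivity))]
      exact Real.one_le_sqrt.mpr hi1
  · -- same endpoint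
    have hK0 : K ≠ 0 := by omega
    simp [g, g', hK0]
  · have hK0 : K ≠ 0 := by omega
    simp [g, hK0]
  · -- different bare couplings
    simp [g, g']

/-- **THE REFERENCE RUN IS LOAD-BEARING: NO ENDPOINT THRESHOLD IN (C, θ, γ) GIVES UNIQUENESS FROM THE MODULI ALONE.**  There is NO function
e₀(C, θ, γ) > 0 such that two same-depth runs of (0.20) in ]0, γ] under `HistLipschitz Λ γ S.β`, `FadingMemory C θ Λ` (0 < θ < 1), pinned at a
common endpoint ≤ e₀(C, θ, γ), must coincide — by `noReference_twoRuns` at C = 6, θ = ½, γ = 1 and depth K ≥ 1∕e₀².  Contrast part 2's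
`runs_eq_of_reference_fadingMemory` ∕ `threshold_exists`: WITH one reference run such a threshold exists (in (β*, C, θ, γ, t_K)); and prover 2's
reference-free `…PointwiseFadingOrder.runs_eq_of_fadingMemory_signFree` (gen 44) needs `4Cγ³ ≤ (1 − θ)²` — violated here (C = 6, γ = 1) for every θ:
that smallness cannot be dropped without a reference run.
[cite: Balaban1987RG1, Thm 2 p.259 («g₀ = g₀(ε, g)») with (0.20) p.256 and p.298] -/
theorem no_threshold_without_reference :
    ¬ (∃ e₀ : ℝ → ℝ → ℝ → ℝ, (∀ C θ γ : ℝ, 0 < C → 0 < θ → θ < 1 → 0 < γ → 0 < e₀ C θ γ) ∧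
        ∀ (S : Setting) (γ C θ : ℝ) (Λ : ℕ → ℕ → ℝ) (K : ℕ) (g g' : ℕ → ℝ),
          0 < C → 0 < θ → θ < 1 → 0 < γ → HistLipschitz Λ γ S.β → FadingMemory C θ Λ →
          RGEqH K S.β g → RGEqH K S.β g' →
          (∀ i, i ≤ K → 0 < g i ∧ g i ≤ γ) → (∀ i, i ≤ K → 0 < g' i ∧ g' i ≤ γ) →
          g K = g' K → g K ≤ e₀ C θ γ → ∀ j, j ≤ K → g j = g' j) := by
  rintro ⟨e₀, he₀, h⟩
  have he : 0 < e₀ 6 (1 / 2) 1 := he₀ 6 (1 / 2) 1 (by norm_num) (by norm_num) (by norm_num) one_pos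
  -- a depth K with 1∕√K ≤ e₀
  obtain ⟨K, hK⟩ := exists_nat_ge (1 / (e₀ 6 (1 / 2) 1) ^ 2 + 1)
  have hK1 : 1 ≤ K := by
    have : (1 : ℝ) ≤ K := le_trans (by linarith [sq_nonneg (1 / e₀ 6 (1 / 2) 1), (by positivity : (0:ℝ) ≤ 1 / (e₀ 6 (1/2) 1) ^ 2)]) hK
    exact_mod_cast this
  obtain ⟨S, Λ, g, g', hL, hΛ, hg, hg', hbox, hbox', hpin, hend, hne⟩ := noReference_twoRuns K hK1
  have hsmall : g K ≤ e₀ 6 (1 / 2) 1 := by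
    rw [hend]
    have hKpos : (0 : ℝ) < K := by exact_mod_cast hK1
    have h1 : 1 / (e₀ 6 (1 / 2) 1) ^ 2 ≤ K := by linarith
    -- 1/√K ≤ e₀ ⟸ 1/e₀² ≤ K
    rw [div_le_iff₀ (Real.sqrt_pos.mpr hKpos)]
    have h2 : 1 / e₀ 6 (1 / 2) 1 ≤ Real.sqrt K := by
      rw [← Real.sqrt_sq (le_of_lt (one_div_pos.mpr he))]
      exact Real.sqrt_le_sqrt (by rw [one_div_pow]; exact h1)
    calc (1 : ℝ) = e₀ 6 (1 / 2) 1 * (1 / e₀ 6 (1 / 2) 1) := by field_simp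
      _ ≤ e₀ 6 (1 / 2) 1 * Real.sqrt K := mul_le_mul_of_nonneg_left h2 he.le
  exact hne (h S 1 6 (1 / 2) Λ K g g' (by norm_num) (by norm_num) (by norm_num) one_pos hL (hΛ (1 / 2) (by norm_num))
    hg hg' hbox hbox' hpin hsmall 0 (Nat.zero_le K))

end

end Summit.QuantumFields.BalabanUV.Beta.EriceFlowEnclosureB12AsPrintedHistoryContagionSharp
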